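import Literature.NumberTheory.Rogawski1990.ArchExplicitTransferFactorCurveSmooth      -- ★ p839780 (this seat): `differentiableAt_archTau∕archExplicitDelta_archSingularCurve`; brings CurveDeriv, B-p12's curve
import HarnessLib

/-!
# Rogawski's archimedean explicit factor along the singular curve AT `ψ = 0`: the values `D(0) = Π_w|z₁ − z₀|²`, `t(0)`, `Δ″_∞(0)`, the `ψ ↦ −ψ` symmetry, and
# `∂_ψ D(0) = ∂_ψ τ_∞(0) = ∂_ψ Δ″_∞(0) = 0` (Rogawski (1990) §8.2 (8.2.1) p. 123)

Topic `NumberTheory/Rogawski1990`; namespace `Literature.NumberTheory.Rogawski1990`.  THEOREMS ONLY (no definition, no named fact, no instance, no notation,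
no `sorry`; net debt 0).  Cell `pub/hodgecm-mathlib`, F0∕P3a, topic T6 (#88 side; brick «CurveAtZero», LEAD F0P3a-plan (g9) T8-16 (B)(4): the derivative-free
constants at `ψ = 0` and the closed-form derivative of `Δ″_∞` there, for p06's (J-cw) product rule `(Δ″·g)′(0)` and the (J-nc)∕(J-sgn) letters' constants).
Over ★ `ArchExplicitTransferFactorCurveSmooth` (p839780) ∕ ★ `…CurveDeriv` (p839618) ∕ ★ B-p12 `ArchSingularCurveNormPair` (p839172) — binders VERBATIM, consumers
pass `_ _ rfl rfl`.  Mathlib-only footing; count-neutral for the books.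

THE MATHEMATICS.  Along print's curve the two moving eigenvalues at a complex place `w` are `a_w(ψ) = e_w e^{i c_w ψ}` and `b_w(ψ) = e_w e^{−i c_w ψ}` with the SAME
base point `e_w = z₀,w,0 = z₀,w,2` (`h02`), while `u_w = z₀,w,1` does not move.  Hence `ψ ↦ −ψ` SWAPS `a_w` and `b_w`: `τ`'s argument
`t_w(ψ) = −(u_w − a_w)(u_w − b_w)∕(a_w b_w)` and `|χ_{g(ψ)}(u)|_w = |(u_w − a_w)(u_w − b_w)|` are EVEN in `ψ`, so `t(−ψ) = t(ψ)` in `L ⊗ ℝ`, `D(−ψ) = D(ψ)`,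
`τ_∞(−ψ) = τ_∞(ψ)`; and since `Π_w κ_w` is frozen near `0` (★ `eventually_prod_archKappaAt_archSingularCurve_eq`) also `Δ″_∞(−ψ) = Δ″_∞(ψ)` for `ψ` near `0`.
An even function differentiable at `0` has derivative `0` there; with ★ `differentiableAt_archWeylRatio∕archTau∕archExplicitDelta_archSingularCurve` this gives
`∂_ψ D(0) = ∂_ψ τ_∞(0) = ∂_ψ Δ″_∞(0) = 0` — in the (J-cw) product rule `(Δ″_∞ · g)′(0) = Δ″_∞(0) · g′(0)`.  At `ψ = 0`: `g(0) = e·1₂` (★ `coe_fst_archSingularCurveH_zero`),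
`D(0) = Π_w |z₀,w,1 − z₀,w,0|²` (★ D-S2∞ ∕ ★ `prod_norm_evalC_archGammaTwo_sub_sq_eq`), `σ_w t(0) = −(z₀,w,1 − z₀,w,0)²∕z₀,w,0²`, `Δ″_∞(0) = τ_∞(0)·D(0)·Π_w κ_w(0)`.

* §1 (values at `0`) `evalC_archTauArg_archSingularCurveH_zero`, **`archWeylRatio_archSingularCurve_zero`**, `archExplicitDelta_archSingularCurve_zero`.
* §2 (the symmetry) `archTauArg_archSingularCurveH_neg`, `archWeylRatio_archSingularCurve_neg`, `archTau_archSingularCurve_neg`, **`eventually_archExplicitDelta_archSingularCurve_neg`**.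
* §3 (derivatives) **`hasDerivAt_archWeylRatio_archSingularCurve`** (`= 0`), **`hasDerivAt_archTau_archSingularCurve`** (`= 0`),
  **`hasDerivAt_archExplicitDelta_archSingularCurve`** (`= 0`), `deriv_archExplicitDelta_archSingularCurve`.

HONEST LABEL: HC_CM is proved only modulo the printed citations (named inputs remaining 2) until rung 0 closes; this file proves none of them.

## References
* [Rogawski1990] J. D. Rogawski, *Automorphic Representations of Unitary Groups in Three Variables*, Ann. of Math. Stud. 123 (1990): §8.2 pp. 122–123 ((8.2.1); the curve
  `γ(θ,φ,ψ)`, `γ₁ = γ(θ,φ,−ψ)` stably conjugate to `γ` in `H`), §4.9 p. 55, §14.6 p. 242.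
-/

set_option autoImplicit false

noncomputable section

open NumberField NumberField.InfinitePlace Matrix Polynomial Filter Topology Complex
open scoped MatrixGroups

namespace Literature.NumberTheory.Rogawski1990

open Literature.NumberTheory.Automorphic
open Literature.NumberTheory.GaloisRepresentations

/-- An even function (near `0`) that is differentiable at `0` has derivative `0` there. [folklore] -/
private theorem hasDerivAt_eq_zero_of_eventually_even {F : Type*} [NormedAddCommGroup F] [NormedSpace ℝ F] {f : ℝ → F} {f' : F}
    (hf : HasDerivAt f f' 0) (heven : ∀ᶠ x in 𝓝 (0 : ℝ), f (-x) = f x) : f' = 0 := by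
  have hg : HasDerivAt f f' (-(0 : ℝ)) := by rw [neg_zero]; exact hf
  have hcomp : HasDerivAt (f ∘ fun x : ℝ => -x) ((-1 : ℝ) • f') 0 := hg.scomp (0 : ℝ) (hasDerivAt_neg' (0 : ℝ))
  have hcongr : HasDerivAt f ((-1 : ℝ) • f') 0 := hcomp.congr_of_eventuallyEq (heven.mono fun x hx => hx.symm)
  have h := hf.unique hcongr
  rw [neg_one_smul] at h
  -- `f' = -f'` forces `f' = 0`
  have h2 : (2 : ℝ) • f' = 0 := by rw [two_smul]; nth_rewrite 2 [h]; exact add_neg_cancel f'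
  rcases smul_eq_zero.1 h2 with h0 | h0
  · norm_num at h0
  · exact h0

section Curve

variable (L : Type) [Field L] [NumberField L] [IsCMField L] (α : Fin 3 → L)
  (z₀ : {w : InfinitePlace L // IsComplex w} → Fin 3 → Circle) (c : {w : InfinitePlace L // IsComplex w} → ℝ)
  (γH : ℝ →
    ↥(UnitaryGroup.arch (↥(maximalRealSubfield L)) L (IsCMField.complexConj L) 2
        (Matrix.of fun i j : Fin 2 => if i.val + j.val + 1 = 2 then (1 : L) else 0)) ×
      ↥(UnitaryGroup.arch (↥(maximalRealSubfield L)) L (IsCMField.complexConj L) 1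
        (Matrix.of fun i j : Fin 1 => if i.val + j.val + 1 = 1 then (1 : L) else 0)))
  (γG : ℝ → ↥(UnitaryGroup.arch (↥(maximalRealSubfield L)) L (IsCMField.complexConj L) 3 (Matrix.diagonal α)))
  (hγH : γH = fun ψ =>
    ((UnitaryGroup.archPiEquivCM 2 L (Matrix.of fun i j : Fin 2 => if i.val + j.val + 1 = 2 then (1 : L) else 0)).symm fun w =>
        ⟨Matrix.GeneralLinearGroup.mkOfDetNeZero !![(1 : ℂ), 1; 1, -1] UnitaryGroup.det_cayleyTwo_ne_zero *
            UnitaryGroup.circleDiagonal 2 ![z₀ w 0 * Circle.exp (![(1 : ℝ), 0, -1] 0 * (c w * ψ)), z₀ w 2 * Circle.exp (![(1 : ℝ), 0, -1] 2 * (c w * ψ))] *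
          (Matrix.GeneralLinearGroup.mkOfDetNeZero !![(1 : ℂ), 1; 1, -1] UnitaryGroup.det_cayleyTwo_ne_zero)⁻¹,
          UnitaryGroup.cayley_conj_circleDiagonal_mem_archLocal L w _⟩,
      (UnitaryGroup.archPiEquivCM 1 L (Matrix.of fun i j : Fin 1 => if i.val + j.val + 1 = 1 then (1 : L) else 0)).symm fun w =>
        ⟨UnitaryGroup.circleDiagonal 1 ![z₀ w 1 * Circle.exp (![(1 : ℝ), 0, -1] 1 * (c w * ψ))],
          UnitaryGroup.circleDiagonal_mem_archLocal_antidiagOne L w _⟩))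
  (hγG : γG = fun ψ => UnitaryGroup.archDiagTorus L 3 α fun w i => z₀ w i * Circle.exp (![(1 : ℝ), 0, -1] i * (c w * ψ)))
  (h02 : ∀ w, z₀ w 0 = z₀ w 2) (h01 : ∀ w, z₀ w 0 ≠ z₀ w 1)
  (μ : HeckeCharacter L) (hherm : ((Matrix.diagonal α).map (cmConjRingHom L)).transpose = Matrix.diagonal α)
  (hanis : ∀ x : Fin 3 → L, Literature.AlgebraicGeometry.ShimuraVarieties.hermForm (cmConjRingHom L) (Matrix.diagonal α) x x = 0 → x = 0)

/-! ## §0 The swap `a_w(−ψ) = b_w(ψ)`, `b_w(−ψ) = a_w(ψ)` of the two moving eigenvalues -/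

omit [NumberField L] [IsCMField L] in
include h02 in
/-- `a_w(−ψ) = b_w(ψ)`: `z₀,w,0·e^{ic(−ψ)} = z₀,w,2·e^{−icψ}` (same base point, `h02`). [cite: Rogawski1990, §8.2 p. 122] -/
private theorem coord_zero_neg (w : {w : InfinitePlace L // IsComplex w}) (ψ : ℝ) :
    z₀ w 0 * Circle.exp (![(1 : ℝ), 0, -1] 0 * (c w * -ψ)) = z₀ w 2 * Circle.exp (![(1 : ℝ), 0, -1] 2 * (c w * ψ)) := by
  rw [h02 w]
  congr 2
  simp only [Matrix.cons_val_zero, Matrix.cons_val_two, Matrix.tail_cons, Matrix.head_cons]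
  ring

omit [NumberField L] [IsCMField L] in
include h02 in
/-- `b_w(−ψ) = a_w(ψ)`. [cite: Rogawski1990, §8.2 p. 122] -/
private theorem coord_two_neg (w : {w : InfinitePlace L // IsComplex w}) (ψ : ℝ) :
    z₀ w 2 * Circle.exp (![(1 : ℝ), 0, -1] 2 * (c w * -ψ)) = z₀ w 0 * Circle.exp (![(1 : ℝ), 0, -1] 0 * (c w * ψ)) := by
  rw [← h02 w]
  congr 2
  simp only [Matrix.cons_val_zero, Matrix.cons_val_two, Matrix.tail_cons, Matrix.head_cons]
  ring

/-! ## §1 The values at `ψ = 0` -/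

include hγH h02 in
/-- **`σ_w t(0) = −(z₀,w,1 − z₀,w,0)² · (z₀,w,0²)⁻¹`** — `τ`'s argument at the singular point, per complex place (★ `evalC_archTauArg_archSingularCurveH` at `ψ = 0`).
[cite: Rogawski1990, §8.2 p. 123; §4.9 p. 55] -/
theorem evalC_archTauArg_archSingularCurveH_zero (w : {w : InfinitePlace L // IsComplex w}) :
    UnitaryGroup.evalC L w (archTauArg L (γH 0)) = -(((z₀ w 1 : ℂ) - z₀ w 0) ^ 2) * ((z₀ w 0 : ℂ) ^ 2)⁻¹ := by
  rw [evalC_archTauArg_archSingularCurveH L z₀ c γH hγH 0 w]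
  simp only [mul_zero, Circle.exp_zero, mul_one]
  rw [← h02 w]
  ring

include hγH h02 in
open scoped Classical in
/-- **`D_{G∕H,∞}(γ_H(0)) = Π_w |z₀,w,1 − z₀,w,0|²`** — the VALUE of the Weyl ratio at the singular point (print: `|e^{iφ} − e^{iθ}|²` per place; ★ D-S2∞
`archWeylRatio_of_fst_eq_smul_one` read through ★ `coe_fst_archSingularCurveH_zero`). [cite: Rogawski1990, §8.2 pp. 122–123; §4.9 p. 55] -/
theorem archWeylRatio_archSingularCurve_zero :
    archWeylRatio L (γH 0) = ∏ w : {w : InfinitePlace L // IsComplex w}, ‖(z₀ w 1 : ℂ) - z₀ w 0‖ ^ 2 := by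
  rw [archWeylRatio_of_fst_eq_smul_one L (γH 0) (coe_fst_archSingularCurveH_zero L z₀ c γH hγH h02),
    prod_norm_evalC_archGammaTwo_sub_sq_eq L z₀ c γH hγH h02]

include hγH hγG h02 in
open scoped Classical in
/-- **`Δ″_∞(γ_H(0), γ(0)) = τ_∞(0) · Π_w |z₀,w,1 − z₀,w,0|² · Π_w κ_w(0)`** (★ `archExplicitDelta_of_isArchNormPair` at the matching pair `ψ = 0`).
[cite: Rogawski1990, §14.6 p. 242; §8.2 p. 123] -/
theorem archExplicitDelta_archSingularCurve_zero :
    archExplicitDelta L (Matrix.diagonal α) (γH 0) μ (γG 0) =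
      archTau L (γH 0) μ * ((∏ w : {w : InfinitePlace L // IsComplex w}, ‖(z₀ w 1 : ℂ) - z₀ w 0‖ ^ 2 : ℝ) : ℂ) *
        ((∏ w : {w : InfinitePlace L // IsComplex w}, archKappaAt L (Matrix.diagonal α) (γH 0) w (γG 0) : ℤ) : ℂ) := by
  rw [archExplicitDelta_of_isArchNormPair L (Matrix.diagonal α) (γH 0) μ (isArchNormPair_archSingularCurve L α z₀ c γH γG hγH hγG 0),
    archWeylRatio_archSingularCurve_zero L z₀ c γH hγH h02]

/-! ## §2 The `ψ ↦ −ψ` symmetry -/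

include hγH h02 in
/-- **`t(−ψ) = t(ψ)` in `L ⊗ ℝ`**: `ψ ↦ −ψ` swaps the two moving eigenvalues, and `τ`'s argument is symmetric in them. [cite: Rogawski1990, §8.2 p. 122] -/
theorem archTauArg_archSingularCurveH_neg (ψ : ℝ) : archTauArg L (γH (-ψ)) = archTauArg L (γH ψ) :=
  UnitaryGroup.mixedSpace_ext (↥(maximalRealSubfield L)) L (IsCMField.complexConj L) (IsCMField.complexConj_ne_one L)
    (UnitaryGroup.complexConj_smul_infinitePlace L) fun w => by
      rw [← UnitaryGroup.evalC_apply, ← UnitaryGroup.evalC_apply, evalC_archTauArg_archSingularCurveH L z₀ c γH hγH (-ψ) w,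
        evalC_archTauArg_archSingularCurveH L z₀ c γH hγH ψ w, coord_zero_neg L z₀ c h02 w ψ, coord_two_neg L z₀ c h02 w ψ]
      ring

include hγH h02 in
open scoped Classical in
/-- **`D(−ψ) = D(ψ)`**. [cite: Rogawski1990, §8.2 p. 122; §4.9 p. 55] -/
theorem archWeylRatio_archSingularCurve_neg (ψ : ℝ) : archWeylRatio L (γH (-ψ)) = archWeylRatio L (γH ψ) := by
  unfold archWeylRatio
  refine Finset.prod_congr rfl fun w _ => ?_
  rw [evalC_eval_archCharpolyTwo_archSingularCurveH L z₀ c γH hγH (-ψ) w, evalC_eval_archCharpolyTwo_archSingularCurveH L z₀ c γH hγH ψ w,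
    coord_zero_neg L z₀ c h02 w ψ, coord_two_neg L z₀ c h02 w ψ, mul_comm]

include hγH h02 in
/-- **`τ_∞(−ψ) = τ_∞(ψ)`** (`u` does not move, `t` is even). [cite: Rogawski1990, §8.2 p. 123] -/
theorem archTau_archSingularCurve_neg (ψ : ℝ) : archTau L (γH (-ψ)) μ = archTau L (γH ψ) μ := by
  unfold archTau
  rw [archTauArg_archSingularCurveH_neg L z₀ c γH hγH h02 ψ, archGammaTwo_archSingularCurveH_eq L z₀ c γH hγH (-ψ),
    archGammaTwo_archSingularCurveH_eq L z₀ c γH hγH ψ]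

include hγH hγG h02 h01 hherm hanis in
open scoped Classical in
/-- **`Δ″_∞(γ_H(−ψ), γ(−ψ)) = Δ″_∞(γ_H(ψ), γ(ψ))` for `ψ` near `0`** — `τ_∞`, `D` even and `Π_w κ_w` frozen on both sides of `0`
(★ `eventually_prod_archKappaAt_archSingularCurve_eq`). [cite: Rogawski1990, §8.2 pp. 122–123; §14.6 p. 242] -/
theorem eventually_archExplicitDelta_archSingularCurve_neg :
    ∀ᶠ ψ in 𝓝 (0 : ℝ), archExplicitDelta L (Matrix.diagonal α) (γH (-ψ)) μ (γG (-ψ)) = archExplicitDelta L (Matrix.diagonal α) (γH ψ) μ (γG ψ) := by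
  have hκ := eventually_prod_archKappaAt_archSingularCurve_eq L α z₀ c γH γG hγH hγG h02 h01 hherm hanis
  have hneg : Tendsto (fun ψ : ℝ => -ψ) (𝓝 0) (𝓝 0) := by simpa only [neg_zero] using (continuous_neg.tendsto (0 : ℝ))
  filter_upwards [hκ, hneg.eventually hκ] with ψ hψ hψ'
  rw [archExplicitDelta_of_isArchNormPair L (Matrix.diagonal α) (γH (-ψ)) μ (isArchNormPair_archSingularCurve L α z₀ c γH γG hγH hγG (-ψ)),
    archExplicitDelta_of_isArchNormPair L (Matrix.diagonal α) (γH ψ) μ (isArchNormPair_archSingularCurve L α z₀ c γH γG hγH hγG ψ),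
    archTau_archSingularCurve_neg L z₀ c γH hγH h02 μ ψ, archWeylRatio_archSingularCurve_neg L z₀ c γH hγH h02 ψ, hψ', hψ]

/-! ## §3 The derivatives at `ψ = 0` vanish -/

include hγH h02 h01 in
/-- **`∂_ψ D_{G∕H,∞}(γ_H(ψ))|_{ψ=0} = 0`** (`D` is even and differentiable at `0`, ★ `differentiableAt_archWeylRatio_archSingularCurve`). [cite: Rogawski1990, §8.2 (8.2.1) p. 123] -/
theorem hasDerivAt_archWeylRatio_archSingularCurve : HasDerivAt (fun ψ => archWeylRatio L (γH ψ)) 0 0 := by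
  have hd := (differentiableAt_archWeylRatio_archSingularCurve L z₀ c γH hγH h02 h01).hasDerivAt
  have h0 := hasDerivAt_eq_zero_of_eventually_even hd (Filter.Eventually.of_forall fun ψ => archWeylRatio_archSingularCurve_neg L z₀ c γH hγH h02 ψ)
  rwa [h0] at hd

include hγH h02 h01 in
/-- **`∂_ψ τ_∞(γ_H(ψ))|_{ψ=0} = 0`** (`τ_∞` is even and differentiable at `0`, ★ `differentiableAt_archTau_archSingularCurve`). [cite: Rogawski1990, §8.2 (8.2.1) p. 123] -/
theorem hasDerivAt_archTau_archSingularCurve : HasDerivAt (fun ψ => archTau L (γH ψ) μ) 0 0 := by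
  have hd := (differentiableAt_archTau_archSingularCurve L z₀ c γH hγH h02 h01 μ).hasDerivAt
  have h0 := hasDerivAt_eq_zero_of_eventually_even hd (Filter.Eventually.of_forall fun ψ => archTau_archSingularCurve_neg L z₀ c γH hγH h02 μ ψ)
  rwa [h0] at hd

include hγH hγG h02 h01 hherm hanis in
open scoped Classical in
/-- **`∂_ψ Δ″_∞(γ_H(ψ), γ(ψ))|_{ψ=0} = 0`** — the closed form of the transfer factor's `ψ`-derivative at the singular point: in the (J-cw) product rule
`(Δ″_∞ · g)′(0) = Δ″_∞(0) · g′(0)`. (`Δ″_∞` is even near `0` and differentiable at `0`, ★ `differentiableAt_archExplicitDelta_archSingularCurve`.)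
[cite: Rogawski1990, §8.2 (8.2.1) p. 123; §14.6 p. 242] -/
theorem hasDerivAt_archExplicitDelta_archSingularCurve :
    HasDerivAt (fun ψ => archExplicitDelta L (Matrix.diagonal α) (γH ψ) μ (γG ψ)) 0 0 := by
  have hd := (differentiableAt_archExplicitDelta_archSingularCurve L α z₀ c γH γG hγH hγG h02 h01 μ hherm hanis).hasDerivAt
  have h0 := hasDerivAt_eq_zero_of_eventually_even hd
    (eventually_archExplicitDelta_archSingularCurve_neg L α z₀ c γH γG hγH hγG h02 h01 μ hherm hanis)
  rwa [h0] at hd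

include hγH hγG h02 h01 hherm hanis in
open scoped Classical in
/-- `deriv (ψ ↦ Δ″_∞(γ_H(ψ), γ(ψ))) 0 = 0`. [cite: Rogawski1990, §8.2 (8.2.1) p. 123] -/
theorem deriv_archExplicitDelta_archSingularCurve :
    deriv (fun ψ => archExplicitDelta L (Matrix.diagonal α) (γH ψ) μ (γG ψ)) 0 = 0 :=
  (hasDerivAt_archExplicitDelta_archSingularCurve L α z₀ c γH γG hγH hγG h02 h01 μ hherm hanis).deriv

end Curve

end Literature.NumberTheory.Rogawski1990

end
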